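import Mathlib
import Summits.ResolutionOfSingularities.ResolutionOfSingularities.Theorems.WildQuotientsWildQuotientResolutionCyclicTransferInvariants
import Summits.ResolutionOfSingularities.ResolutionOfSingularities.Theorems.WildQuotientsWildQuotientResolutionCyclicTransferStalkAugRestrict
import Literature.AlgebraicGeometry.RelativeSpec.FiniteGroupQuotientGluing

/-!
# Cyclic divisorial transfer — chart form on a `G`-stable open
(crux stmt-ResolutionOfSingularities-15640 `WildQuotients.WildQuotientResolution`, line `Sketch`,
helper A1′ of `L/w45c/CHAIN.md`)

The chart-ring regularity `CyclicTransfer.isRegularRing_invariantsRing` for the action restricted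
to a `G`-stable open `O ⊆ X` affine over the base (`ActionOver.restrict`,
`ActionOver.StableAffineOpens`): for `G` of prime order `p` acting on a regular integral `X`,
locally of finite type over a locally Noetherian `Y`, with the stalk augmentation ideals
principal at fixed points (Király–Lütkebohmert terminal state), every ring of invariants
`Γ(O, (O ↪ X → Y)⁻¹U)^G` (`U ⊆ Y` affine open) is a regular ring. This is exactly the hypothesis
of `CyclicTransfer.stub_isRegular_glued`, whence the glued quotient `X/G` is regular
(`isRegular_glued_of_stalkAug`).
-/

set_option linter.dupNamespace false

noncomputable section

open CategoryTheory Limits AlgebraicGeometry TopologicalSpace IsLocalRing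
open Literature.AlgebraicGeometry.Resolution Literature.AlgebraicGeometry.RelativeSpec

namespace Summit.ResolutionOfSingularities.ResolutionOfSingularities.Theorems.WildQuotientResolution.CyclicTransfer

/-- **Chart form on a `G`-stable open (A1′).** `ρ` an action of a group `G` of prime order `p`
on the regular integral scheme `X` over `r : X → Y`, with `r` locally of finite type and `Y`
locally Noetherian; if for every `g` and every `g`-fixed point `x` the augmentation ideal
`(g♯ s - s : s ∈ 𝒪_{X,x})` of the stalk action is principal, then for every `G`-stable open
`O ⊆ X` affine over `Y` and every affine open `U ⊆ Y` the ring of invariants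
`Γ(O, (O ↪ X → Y)⁻¹U)^G` of the restricted action is a regular ring. (A prime of the ring of
invariants lies under a prime of `Γ(O, (O ↪ X → Y)⁻¹U)`, which gives a point of `O`, so `O` is a
non-empty open subscheme: integral and regular; the stalk hypothesis restricts to `O`
(`stub_stalkAug_restrict`); conclude by `isRegularRing_invariantsRing`, Noetherianity of the
invariants by E. Noether (`ActionOver.finiteType_diagramMap_invariants`).)
[cite: KiralyLutkebohmert2013, Thm 2] [cite: SGA1, Exp. V, Cor. 1.5] -/
theorem isRegularRing_invariantsRing_restrict {X Y : Scheme.{0}} {r : X ⟶ Y} {G : Type}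
    [Group G] [Finite G] (ρ : ActionOver r G) {p : ℕ} (hp : p.Prime) (hcard : Nat.card G = p)
    [IsIntegral X] (hreg : Scheme.IsRegular X) [LocallyOfFiniteType r] [IsLocallyNoetherian Y]
    (hdiv : ∀ (g : G) (x : X) (hgx : (ρ.aut g).hom.base x = x),
      (Ideal.span (Set.range fun s : X.presheaf.stalk x =>
        (X.presheaf.stalkSpecializes (specializes_of_eq hgx) ≫ (ρ.aut g).hom.stalkMap x).hom s -
          s)).IsPrincipal)
    (O : ρ.StableAffineOpens) (U : Y.affineOpens) :
    IsRegularRing ((ρ.restrict O.1 O.2.1).invariants.ring U.1) := by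
  classical
  rw [ActionOver.invariants_ring]
  -- the restricted action, over `O ↪ X → Y` (affine, locally of finite type)
  haveI : IsAffineHom (O.1.ι ≫ r) := O.2.2
  haveI : LocallyOfFiniteType (O.1.ι ≫ r) := inferInstance
  haveI : IsLocallyNoetherian (O.1 : Scheme.{0}) :=
    LocallyOfFiniteType.isLocallyNoetherian (O.1.ι ≫ r)
  have hU' : IsAffineOpen ((O.1.ι ≫ r) ⁻¹ᵁ U.1) := U.2.preimage (O.1.ι ≫ r)
  -- Noetherianity of the invariants (E. Noether)
  haveI : IsNoetherianRing Γ(Y, U.1) := IsLocallyNoetherian.component_noetherian U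
  haveI : IsNoetherianRing ((ρ.restrict O.1 O.2.1).invariantsRing U.1) := by
    have h := (ρ.restrict O.1 O.2.1).finiteType_diagramMap_invariants U
    letI algAB : Algebra Γ(Y, U.1) ((ρ.restrict O.1 O.2.1).invariantsRing U.1) :=
      ((ρ.restrict O.1 O.2.1).invariants.diagramMap.app (.op U.1)).hom.toAlgebra
    haveI : Algebra.FiniteType Γ(Y, U.1) ((ρ.restrict O.1 O.2.1).invariantsRing U.1) := h
    exact Algebra.FiniteType.isNoetherianRing Γ(Y, U.1) ((ρ.restrict O.1 O.2.1).invariantsRing U.1)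
  letI := (ρ.restrict O.1 O.2.1).mulSemiringAction U.1
  haveI := (ρ.restrict O.1 O.2.1).isInvariant_invariantsRing U.1
  haveI : Algebra.IsIntegral ((ρ.restrict O.1 O.2.1).invariantsRing U.1)
      Γ(O.1, (O.1.ι ≫ r) ⁻¹ᵁ U.1) :=
    Algebra.IsInvariant.isIntegral ((ρ.restrict O.1 O.2.1).invariantsRing U.1)
      Γ(O.1, (O.1.ι ≫ r) ⁻¹ᵁ U.1) G
  refine isRegularRing_iff.mpr fun 𝔭 _ => ?_
  -- a prime of the invariants lies under a prime of the sections, which gives a point of `O`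
  obtain ⟨𝔮, -, h𝔮, -⟩ := Ideal.exists_ideal_over_prime_of_isIntegral 𝔭
    (⊥ : Ideal Γ(O.1, (O.1.ι ≫ r) ⁻¹ᵁ U.1))
    (by
      rw [← RingHom.ker_eq_comap_bot, (RingHom.injective_iff_ker_eq_bot _).mp]
      · exact bot_le
      · exact Subtype.val_injective)
  haveI : Nonempty (O.1 : Scheme.{0}) := ⟨hU'.fromSpec.base ⟨𝔮, h𝔮⟩⟩
  haveI : IsIntegral (O.1 : Scheme.{0}) := isIntegral_of_isOpenImmersion O.1.ι
  have hregO : Scheme.IsRegular (O.1 : Scheme.{0}) := fun y => by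
    haveI := hreg (O.1.ι.base y)
    exact IsRegularLocalRing.of_ringEquiv (asIso (O.1.ι.stalkMap y)).commRingCatIsoToRingEquiv
  -- the stalk hypothesis on `O`
  have hdivO : ∀ (g : G) (x : (O.1 : Scheme.{0}))
      (hgx : ((ρ.restrict O.1 O.2.1).aut g).hom.base x = x),
      (Ideal.span (Set.range fun s : (O.1 : Scheme.{0}).presheaf.stalk x =>
        ((O.1 : Scheme.{0}).presheaf.stalkSpecializes (specializes_of_eq hgx) ≫
          ((ρ.restrict O.1 O.2.1).aut g).hom.stalkMap x).hom s - s)).IsPrincipal := by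
    intro g x hgx
    have hgx0 : (ρ.aut g).hom.base x.1 = x.1 := by
      have h1 := ρ.ι_restrictHom_apply O.1 O.2.1 g x
      simp only [Scheme.Opens.ι_apply] at h1
      rw [← ActionOver.restrict_aut_hom, hgx] at h1
      exact h1.symm
    obtain ⟨_, h⟩ := stub_stalkAug_restrict ρ O.1 O.2.1 g x hgx0 (hdiv g x.1 hgx0)
    exact h
  haveI : IsRegularRing ((ρ.restrict O.1 O.2.1).invariantsRing U.1) :=
    isRegularRing_invariantsRing (ρ.restrict O.1 O.2.1) hp hcard hregO U.1 hU' hdivO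
  infer_instance

end Summit.ResolutionOfSingularities.ResolutionOfSingularities.Theorems.WildQuotientResolution.CyclicTransfer

end
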